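import Summits.CriticalPhenomena.PercolationContinuityZ3.Theorems.PercNearOneGluingNoHeavyLowerTailQ7PsiZFree
import HarnessLib

/-!
# `NoHeavyLowerTail` (stmt-CriticalPhenomena-4575) — the observer/strong-relay covariance comparison
# for a SET of observers (the `z`-free core of the set-observer programme = Kozma–Nitzan Question 9)

Support file (`--supports stmt-CriticalPhenomena-4575`), coupling seat `prim-cplus-coupling` (gen 13).  No
definitions, no named facts, no sorries.

Context (seat memo A5-COUPLING-gen13.md §0–§3).  Kozma–Nitzan's Question 9 (arXiv:2401.12397, p. 36) — the
pre-FKG inequality (41) for the relay least connected to `b` in the graph WITH THE OBSERVER'S EDGES REMOVED —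
is equivalent to (41) for a SET `N` of observers with the ordinary designation
(`P(c ↔ b, N ↔ A) ≤ P(N ↔ b, N ↔ A)` for `c = argmin_A P(· ↔ b)`, where `N ↔ v` means `∃ n ∈ N, n ↔ v`;
condition on the open pairs at the observer).  The seat's census (memo §1–§2) shows that the `|A| = 3`
certificate of `…Q7PsiOfCov.lean` survives the passage `o ↦ N` with ONE new atom, the set-observer marker
dominance lemma; this file proves its `z`-free case (the analogue of `Q7Psi.obs_cov_ge`), which is also the
per-cluster input of the `T_A`-induction planned for the full atom:

* `Q7Psi.setObs_neg` — with `D = {x ↮ y}`: `μ(D) · ∫_{D ∩ {x ↮ N} ∩ {y ↔ N}} F(C(x)) ≤ (∫_D F(C(x))) · μ(D ∩ {x ↮ N} ∩ {y ↔ N})`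
  — van den Berg–Häggström–Kahn's Theorem 1.5 (given `x ↮ y`, functions increasing in `C_x` and decreasing in
  `C_y` are positively associated) for `F(C_x)` and `−𝟙{x ↮ N} 𝟙{y ↔ N}`; for a single observer this is their
  Theorem 1.4 (`Q7Psi.obs_neg`), for a set the event `{x ↮ N}` is needed because `x ↔ N`, `y ↔ N`, `x ↮ y` can
  hold together;
* `Q7Psi.harris_setObs_union` — Harris for `F(C(x))` and the increasing event `{x ↔ N} ∪ {y ↔ N}`;
* `Q7Psi.setObs_cov_ge` — **the set-observer covariance comparison**:
  `μ(D ∩ {x ↮ N} ∩ {y ↔ N}) · (∫_{x ↔ y} F(C(x)) − μ(x ↔ y) ∫ F(C(x))) ≤ μ(D) · (∫_{x ↔ N} F(C(x)) − μ(x ↔ N) ∫ F(C(x)))`,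
  i.e. `Cov(F(C_x), 𝟙{x ↔ N}) ≥ P(y ↔ N, x ↮ N | x ↮ y) · Cov(F(C_x), 𝟙{x ↔ y})` for every monotone real cluster
  property `F` and every vertex set `N` (for `N = {o}` it is `Q7Psi.obs_cov_ge`).
Proof: `{x ↔ N} ∪ {y ↔ N} = {x ↔ N} ⊔ (D ∩ {x ↮ N} ∩ {y ↔ N})`, Harris, and `setObs_neg`.
[cite: VandenbergHaggstromKahn2005, Thms 1.4–1.5 (p. 7); §1 p. 6 (Harris)]
[cite: KozmaNitzan2024, Lemma 2 (p. 6), Question 9 (p. 36)]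
-/

namespace Summit.CriticalPhenomena.PercolationContinuityZ3.Theorems

open MeasureTheory Set Literature.Probability.LatticeModels Literature.Probability.Percolation
open scoped Classical
open KNPreFKG

noncomputable section

namespace Q7Psi

variable {V : Type*} [Fintype V]

/-- **BHK Thm 1.5 for a real cluster property and a set of observers**: with `D = {x ↮ y}`,
`μ(D) · ∫_{D ∩ {x ↮ N} ∩ {y ↔ N}} F(C(x)) ≤ (∫_D F(C(x))) · μ(D ∩ {x ↮ N} ∩ {y ↔ N})` — given `x ↮ y`, the
increasing function `F(C_x)` of the cluster of `x` and the function `𝟙{x ↮ N} 𝟙{y ↔ N}` (decreasing in `C_x`,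
increasing in `C_y`) are negatively correlated. [cite: VandenbergHaggstromKahn2005, Thm. 1.5 (p. 7)] -/
theorem setObs_neg (w : Sym2 V → unitInterval) (x y : V) (N : Set V) (hxy : x ≠ y) (F : Set V → ℝ)
    (hF : ∀ S T : Set V, S ⊆ T → F S ≤ F T) :
    (prodBernoulli w).real {ω : BondConfig V | ¬ (openGraph ω).Reachable x y} *
        ∫ ω in {ω : BondConfig V | ¬ (openGraph ω).Reachable x y} ∩
            ({ω | ∀ n ∈ N, ¬ (openGraph ω).Reachable x n} ∩ {ω | ∃ n ∈ N, (openGraph ω).Reachable y n}),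
          F (openCluster ω x) ∂(prodBernoulli w) ≤
      (∫ ω in {ω : BondConfig V | ¬ (openGraph ω).Reachable x y}, F (openCluster ω x) ∂(prodBernoulli w)) *
        (prodBernoulli w).real ({ω : BondConfig V | ¬ (openGraph ω).Reachable x y} ∩
          ({ω | ∀ n ∈ N, ¬ (openGraph ω).Reachable x n} ∩ {ω | ∃ n ∈ N, (openGraph ω).Reachable y n})) := by
  classical
  set E : Set (BondConfig V) :=
    {ω | ∀ n ∈ N, ¬ (openGraph ω).Reachable x n} ∩ {ω | ∃ n ∈ N, (openGraph ω).Reachable y n} with hE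
  -- the two-cluster test function: `−𝟙{no vertex of N in C_x} · 𝟙{some vertex of N in C_y}`
  set G : Set (Sym2 V) → Set (Sym2 V) → ℝ := fun C C' =>
    -(if (∀ n ∈ N, ¬ (n = x ∨ ∃ e ∈ C, n ∈ e)) ∧ (∃ n ∈ N, n = y ∨ ∃ e ∈ C', n ∈ e) then (1 : ℝ) else 0)
    with hG
  have hGmono : ∀ C', Monotone fun C => G C C' := by
    intro C' C₁ C₂ h12
    simp only [hG]
    refine neg_le_neg ?_
    by_cases h2 : (∀ n ∈ N, ¬ (n = x ∨ ∃ e ∈ C₂, n ∈ e)) ∧ (∃ n ∈ N, n = y ∨ ∃ e ∈ C', n ∈ e)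
    · have h1 : (∀ n ∈ N, ¬ (n = x ∨ ∃ e ∈ C₁, n ∈ e)) ∧ (∃ n ∈ N, n = y ∨ ∃ e ∈ C', n ∈ e) :=
        ⟨fun n hn hc => h2.1 n hn (hc.imp id fun ⟨e, he, hne⟩ => ⟨e, h12 he, hne⟩), h2.2⟩
      rw [if_pos h2, if_pos h1]
    · rw [if_neg h2]
      split_ifs
      · exact zero_le_one
      · exact le_rfl
  have hGanti : ∀ C, Antitone fun C' => G C C' := by
    intro C C₁ C₂ h12
    simp only [hG]
    refine neg_le_neg ?_
    by_cases h1 : (∀ n ∈ N, ¬ (n = x ∨ ∃ e ∈ C, n ∈ e)) ∧ (∃ n ∈ N, n = y ∨ ∃ e ∈ C₁, n ∈ e)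
    · have h2 : (∀ n ∈ N, ¬ (n = x ∨ ∃ e ∈ C, n ∈ e)) ∧ (∃ n ∈ N, n = y ∨ ∃ e ∈ C₂, n ∈ e) :=
        ⟨h1.1, h1.2.imp fun n ⟨hn, hc⟩ => ⟨hn, hc.imp id fun ⟨e, he, hne⟩ => ⟨e, h12 he, hne⟩⟩⟩
      rw [if_pos h1, if_pos h2]
    · rw [if_neg h1]
      split_ifs
      · exact zero_le_one
      · exact le_rfl
  have hGval : ∀ ω : BondConfig V,
      G (openEdgeCluster ω x) (openEdgeCluster ω y) = -(E.indicator (1 : BondConfig V → ℝ) ω) := by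
    intro ω
    simp only [hG]
    congr 1
    by_cases hω : ω ∈ E
    · rw [indicator_of_mem hω, Pi.one_apply, if_pos]
      refine ⟨fun n hn hc => hω.1 n hn ((reachable_iff_exists_mem_openEdgeCluster ω x n).2 hc), ?_⟩
      obtain ⟨n, hn, hr⟩ := hω.2
      exact ⟨n, hn, (reachable_iff_exists_mem_openEdgeCluster ω y n).1 hr⟩
    · rw [indicator_of_notMem hω, if_neg]
      rintro ⟨h1, n, hn, hc⟩
      exact hω ⟨fun n' hn' hr => h1 n' hn' ((reachable_iff_exists_mem_openEdgeCluster ω x n').1 hr),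
        n, hn, (reachable_iff_exists_mem_openEdgeCluster ω y n).2 hc⟩
  have key := BHK2006_twoClusterConditionalAssociation_holds V w x y
    (fun C _ => F {a | a = x ∨ ∃ e ∈ C, a ∈ e}) G (fun _ => monotone_clusterFun x F hF)
    (fun _ => antitone_const) hGmono hGanti hxy
  simp only [clusterFun_openEdgeCluster, hGval, mul_neg, integral_neg] at key
  rw [setIntegral_mul_indicator_one, setIntegral_indicator_one_eq] at key
  linarith

/-- **Harris for a real cluster property and the union event of a set of observers**: with
`J = {x ↔ N} ∪ {y ↔ N}`, `μ(J) · ∫ F(C(x)) ≤ ∫_J F(C(x))` — both `F(C_x(ω))` and `𝟙_J` are increasing in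
the configuration. [cite: VandenbergHaggstromKahn2005, §1 p. 6 (Harris' inequality)] -/
theorem harris_setObs_union (w : Sym2 V → unitInterval) (x y : V) (N : Set V) (F : Set V → ℝ)
    (hF : ∀ S T : Set V, S ⊆ T → F S ≤ F T) :
    (prodBernoulli w).real ({ω : BondConfig V | ∃ n ∈ N, (openGraph ω).Reachable x n} ∪
          {ω | ∃ n ∈ N, (openGraph ω).Reachable y n}) * ∫ ω, F (openCluster ω x) ∂(prodBernoulli w) ≤
      ∫ ω in {ω : BondConfig V | ∃ n ∈ N, (openGraph ω).Reachable x n} ∪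
          {ω | ∃ n ∈ N, (openGraph ω).Reachable y n}, F (openCluster ω x) ∂(prodBernoulli w) := by
  classical
  set μ := prodBernoulli w with hμ
  set J : Set (BondConfig V) := {ω : BondConfig V | ∃ n ∈ N, (openGraph ω).Reachable x n} ∪
    {ω | ∃ n ∈ N, (openGraph ω).Reachable y n} with hJ
  have hJm : MeasurableSet J := MeasurableSet.of_discrete
  have hfm : Monotone fun ω : BondConfig V => F (openCluster ω x) :=
    fun ω ω' h => hF _ _ (openCluster_mono h x)
  have hJup : IsUpperSet J := by
    intro ω ω' hle hω
    rcases hω with ⟨n, hn, h⟩ | ⟨n, hn, h⟩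
    · exact Or.inl ⟨n, hn, h.mono (SimpleGraph.fromEdgeSet_mono hle)⟩
    · exact Or.inr ⟨n, hn, h.mono (SimpleGraph.fromEdgeSet_mono hle)⟩
  have hgm : Monotone (J.indicator (1 : BondConfig V → ℝ)) := monotone_indicator_one_of_isUpperSet hJup
  have key := BHK2006.integral_mul_le_prodBernoulli w hfm hgm
  have h1 : ∫ ω, J.indicator (1 : BondConfig V → ℝ) ω ∂μ = μ.real J := by
    rw [integral_indicator_one hJm]
  have h2 : ∫ ω, F (openCluster ω x) * J.indicator (1 : BondConfig V → ℝ) ω ∂μ =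
      ∫ ω in J, F (openCluster ω x) ∂μ := by
    have hfun : (fun ω => F (openCluster ω x) * J.indicator (1 : BondConfig V → ℝ) ω) =
        J.indicator (fun ω => F (openCluster ω x)) := by
      funext ω
      by_cases h : ω ∈ J
      · rw [indicator_of_mem h, indicator_of_mem h, Pi.one_apply, mul_one]
      · rw [indicator_of_notMem h, indicator_of_notMem h, mul_zero]
    rw [hfun, integral_indicator hJm]
  rw [h1, h2] at key
  linarith [key]

/-- **The set-observer covariance comparison** (the `z`-free core of the set-observer / Question-9
programme).  With `D = {x ↮ y}`, `{x ↔ N} = {∃ n ∈ N, x ↔ n}`, `{x ↮ N}` its complement and `{y ↔ N}` likewise: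
`μ(D ∩ {x ↮ N} ∩ {y ↔ N}) · (∫_{x↔y} F(C(x)) − μ(x↔y) ∫ F(C(x))) ≤ μ(D) · (∫_{x↔N} F(C(x)) − μ(x↔N) ∫ F(C(x)))`,
i.e. `Cov(F(C_x), 𝟙{x ↔ N}) ≥ P(y ↔ N, x ↮ N | x ↮ y) · Cov(F(C_x), 𝟙{x ↔ y})` for every monotone real cluster
property `F` and every vertex set `N`.  For `N = {o}` this is `Q7Psi.obs_cov_ge`; for a set the factor `𝟙{x ↮ N}`
in the coefficient is essential (census: the larger coefficient `P(y ↔ N | x ↮ y)` fails).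
Proof: `J = {x↔N} ∪ {y↔N} = {x↔N} ⊔ (D ∩ {x↮N} ∩ {y↔N})`, `harris_setObs_union`, `setObs_neg`, and `μ` is a
probability measure. [cite: VandenbergHaggstromKahn2005, Thms 1.4–1.5 (p. 7)] [cite: KozmaNitzan2024, Lemma 2 (p. 6), Question 9 (p. 36)] -/
theorem setObs_cov_ge (w : Sym2 V → unitInterval) (x y : V) (N : Set V) (hxy : x ≠ y) (F : Set V → ℝ)
    (hF : ∀ S T : Set V, S ⊆ T → F S ≤ F T) :
    (prodBernoulli w).real ({ω : BondConfig V | ¬ (openGraph ω).Reachable x y} ∩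
          ({ω | ∀ n ∈ N, ¬ (openGraph ω).Reachable x n} ∩ {ω | ∃ n ∈ N, (openGraph ω).Reachable y n})) *
        (∫ ω in openConn x y, F (openCluster ω x) ∂(prodBernoulli w) -
          (prodBernoulli w).real (openConn x y) * ∫ ω, F (openCluster ω x) ∂(prodBernoulli w)) ≤
      (prodBernoulli w).real {ω : BondConfig V | ¬ (openGraph ω).Reachable x y} *
        (∫ ω in {ω : BondConfig V | ∃ n ∈ N, (openGraph ω).Reachable x n}, F (openCluster ω x) ∂(prodBernoulli w) -
          (prodBernoulli w).real {ω : BondConfig V | ∃ n ∈ N, (openGraph ω).Reachable x n} *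
            ∫ ω, F (openCluster ω x) ∂(prodBernoulli w)) := by
  classical
  set μ := prodBernoulli w with hμ
  set D : Set (BondConfig V) := {ω | ¬ (openGraph ω).Reachable x y} with hD
  set O : Set (BondConfig V) := {ω : BondConfig V | ∃ n ∈ N, (openGraph ω).Reachable x n} with hO
  set Oy : Set (BondConfig V) := {ω : BondConfig V | ∃ n ∈ N, (openGraph ω).Reachable y n} with hOy
  set E : Set (BondConfig V) :=
    {ω | ∀ n ∈ N, ¬ (openGraph ω).Reachable x n} ∩ {ω | ∃ n ∈ N, (openGraph ω).Reachable y n} with hE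
  set f : BondConfig V → ℝ := fun ω => F (openCluster ω x) with hf
  set J : Set (BondConfig V) := O ∪ Oy with hJ
  have h15 := setObs_neg w x y N hxy F hF
  change μ.real D * ∫ ω in D ∩ E, f ω ∂μ ≤ (∫ ω in D, f ω ∂μ) * μ.real (D ∩ E) at h15
  have hH := harris_setObs_union w x y N F hF
  change μ.real J * ∫ ω, f ω ∂μ ≤ ∫ ω in J, f ω ∂μ at hH
  show μ.real (D ∩ E) * (∫ ω in openConn x y, f ω ∂μ - μ.real (openConn x y) * ∫ ω, f ω ∂μ) ≤
    μ.real D * (∫ ω in O, f ω ∂μ - μ.real O * ∫ ω, f ω ∂μ)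
  -- `J = {x ↔ N} ⊔ (D ∩ {x ↮ N} ∩ {y ↔ N})`
  have hJeq : J = O ∪ (D ∩ E) := by
    ext ω
    simp only [hJ, hO, hOy, hD, hE, mem_union, mem_inter_iff, mem_setOf_eq]
    constructor
    · rintro (h | ⟨n, hn, h⟩)
      · exact Or.inl h
      · by_cases hxN : ∀ n' ∈ N, ¬ (openGraph ω).Reachable x n'
        · exact Or.inr ⟨fun hxy' => hxN n hn (hxy'.trans h), hxN, n, hn, h⟩
        · simp only [not_forall, not_not] at hxN
          obtain ⟨n', hn', h'⟩ := hxN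
          exact Or.inl ⟨n', hn', h'⟩
    · rintro (h | ⟨_, _, h⟩)
      · exact Or.inl h
      · exact Or.inr h
  have hdisj : Disjoint O (D ∩ E) := by
    rw [Set.disjoint_left]
    rintro ω ⟨n, hn, hxn⟩ ⟨_, hxN, _⟩
    exact hxN n hn hxn
  have hJm : μ.real J = μ.real O + μ.real (D ∩ E) := by
    rw [hJeq, measureReal_union hdisj MeasurableSet.of_discrete]
  have hsplit : ∫ ω in J, f ω ∂μ = ∫ ω in O, f ω ∂μ + ∫ ω in D ∩ E, f ω ∂μ := by
    rw [hJeq]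
    exact setIntegral_union hdisj MeasurableSet.of_discrete (Integrable.of_finite).integrableOn
      (Integrable.of_finite).integrableOn
  -- `∫_D f = ∫ f - ∫_{x↔y} f` and `μ(D) = 1 - μ(x↔y)`
  have hDc : D = (openConn x y)ᶜ := rfl
  have hmD : MeasurableSet (openConn x y : Set (BondConfig V)) := MeasurableSet.of_discrete
  have hIf : ∫ ω in D, f ω ∂μ = ∫ ω, f ω ∂μ - ∫ ω in openConn x y, f ω ∂μ := by
    have e := integral_add_compl hmD (Integrable.of_finite : Integrable f μ)
    rw [hDc]
    linarith
  have hmDc : μ.real D = 1 - μ.real (openConn x y) := by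
    rw [hDc, measureReal_compl hmD, probReal_univ]
  have hDnn : 0 ≤ μ.real D := measureReal_nonneg
  have hEnn : 0 ≤ μ.real (D ∩ E) := measureReal_nonneg
  -- Harris, multiplied by `μ(D)`, with `J` split
  have h1 : μ.real D * (μ.real J * ∫ ω, f ω ∂μ) ≤ μ.real D * ∫ ω in J, f ω ∂μ :=
    mul_le_mul_of_nonneg_left hH hDnn
  rw [hsplit, hJm] at h1
  rw [hIf] at h15
  rw [hmDc] at h1 h15 ⊢
  nlinarith [h1, h15]

end Q7Psi

end

end Summit.CriticalPhenomena.PercolationContinuityZ3.Theorems
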